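import Summits.HodgeConjecture.HodgeConjecture.Theorems.Ring2AbelianAllAndreWeilFieldPencils
import Summits.HodgeConjecture.HodgeConjecture.Theorems.Ring2AbelianAllAndreWeilFieldTypeTransport
import Literature.AlgebraicGeometry.HodgeTheory.WeilClassesIsogenyDescent
import Literature.AlgebraicGeometry.HodgeTheory.WeilClassesFieldAllOrNothing
import Literature.AlgebraicGeometry.HodgeTheory.AbelianVarietyPullbackAlgebraicClasses
import Literature.AlgebraicGeometry.HodgeTheory.AbelianVarietyMultiplicationPullback
import HarnessLib

/-!
# Ring 2 · AbelianAll — ANDRÉ AXIS, PART S-a: `E`-ISOGENY ANCHORS — algebraicity of the `E`-Weil classes and Weil type relative to `E` pass along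
  an `E`-isogeny pair (abelian-variety level), so part R-b's row «`B⋆` of the ONE total space ⟹ the `E`-Weil classes of EVERY member are
  algebraic» holds through a chart `E`-isogenous to ANY anchor with algebraic `E`-Weil classes — in particular to any Weil-type CM datum satisfying
  the Hodge conjecture —, and every member is then of Weil type relative to `E` (fact-free)

HONEST FRAMING (page 1, verbatim): **research route, not a corollary; conditional on HC_CM plus one named minimal statement.** Cell line:
research route conditional on HC_CM; not a corollary; Q11.4-sentence-2 already refuted in dim ≥ 3. Nothing in this file proves a case of the
Hodge conjecture or of `B(X)` for a named `X`: the pencil rows are IMPLICATIONS with displayed hypotheses. `HC_CM`, `HC_AV`, the global nodes and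
Verdier's binder do NOT occur. Item `Theses.RankFourFaces.CMToAbelian` (stmt-16267) stays OPEN; N104 untouched; no node is born (0 `def`,
0 `sorry`, no named fact). Seat `pub-hodge-ring2-ab-andre-2`, gen 49 (part S: CM-field component anchors and twisted squares; owed item (o156)).
Part R-e (gen 48) carried the algebraicity of `W_E` from Deligne's COMPANION tensor point to an `E`-isogenous chart with the tree's
companion-specific lemma `weilClassesField_le_algebraicClasses_of_isogenyPair_companion`; here the transport is proved for an ARBITRARY anchor
`(A₀, φ₀)` (the last paragraph of that lemma's proof, isolated), so that the δ-indexed CM anchors of ring2-b03 (part S-b) and the CM-field twisted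
squares (parts S-c/S-d) feed part R-b's rows through `E`-isogenous charts.

## Content (theorems only; standard axioms)

* §1 (AV level) `weilClassesField_map_le_of_comm` / `map_mem_weilClassesField_of_comm` — an `E`-equivariant homomorphism `g : B ⟶ A`
  (`g ≫ φ = ψ ≫ g`) pulls `W_E(A, φ) ⊗ ℂ` back into `W_E(B, ψ) ⊗ ℂ` (summand by summand: the tree's `map_mem_pullbackEigenclasses_of_comm`).
  **`weilClassesField_le_algebraicClasses_of_isogenyPair`** — if `W_E(A₀, φ₀) ⊗ ℂ ⊆ Nᵏ(A₀)` and `(Y, ψ)` is `E`-ISOGENOUS to `(A₀, φ₀)`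
  (`u : Y ⟶ A₀`, `v : A₀ ⟶ Y`, `u ≫ v = m·𝟙_Y`, `m ≥ 1`, `v ≫ ψ = φ₀ ≫ v`), then `W_E(Y, ψ) ⊗ ℂ ⊆ Nᵏ(Y)` (`v^*` of a Weil class is a Weil
  class of the anchor, algebraic; `u^* v^* = [m]^* = m^{2k}`; Deligne's Remark 4.10 along an isogeny, anchor-free form).
* §2 (AV level) **`isWeilTypeCM_of_isogenyPair`** — WEIL TYPE RELATIVE TO `E` IS AN `E`-ISOGENY INVARIANT: `IsWeilTypeCM A₀ φ₀ R e₀ k`,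
  `u : Y ⟶ A₀` with `u ≫ φ₀ = ψ ≫ u`, `v : A₀ ⟶ Y` with `v ≫ u = m·𝟙_{A₀}` (`m ≥ 1`), `dim Y = dim A₀`, `R(ψ²) = 0` ⟹ `IsWeilTypeCM Y ψ R e₀ k`.
  Proof in the style of part R-c: `W_E(A₀) ⊗ ℂ` carries a non-zero RATIONAL class (the tree's all-or-nothing lemma), of type `(k, k)` (Deligne
  Prop. 4.4 ⟸ for the Weil-type anchor); its pull-back `u^* γ` is a non-zero (`v^* u^* = m^{2k}`) rational `(k, k)`-class of `W_E(Y) ⊗ ℂ`, so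
  Moonen–Zarhin's criterion (a tree theorem) balances the multiplicities of `(Y, ψ)`, `n_ρ = n_ρ̄`, and `n_ρ + n_ρ̄ = 2k`. (The tree had the
  imaginary-quadratic `IsWeilType.of_isIsogeny` only.)
* §3 (pencils) **`weilClassesField_le_algebraicClasses_forall_of_lefschetzB_of_isogenyPair_chart`** — THE ROW THROUGH AN `E`-ISOGENOUS ANCHOR:
  compact pencil of abelian `d`-folds with `B⋆(𝒳, η) ∀η`, a global endomorphism `Φ` over `S`, `Φ`-compatible charts `(A_s, e_s, φ_s)` with
  `P(φ_s) = 0` (`P` irreducible of degree `e`, `e·2m = 2d`), a rational global `U` on `W_E(A_t) ⊗ ℂ` at `t` with `U|X_t ≠ 0`, and ONE chart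
  `A_{s₀}` `E`-isogenous (`u`, `v`, `u ≫ v = n·𝟙`, `v ≫ φ_{s₀} = φ₀ ≫ v`) to ANY `(A₀, φ₀)` with `W_E(A₀, φ₀) ⊗ ℂ ⊆ Nᵐ(A₀)` ⟹
  `W_E(A_s, φ_s) ⊗ ℂ ⊆ Nᵐ(A_s)` for EVERY member; **`…_of_isogenyPair_weilTypeCM_hodge_chart`** — the anchor a Weil-type CM datum
  `IsWeilTypeCM A₀ φ₀ R e₀ k` satisfying `HodgeConjectureFor` (ring2-b03's CM power members on every δ-row; the twisted squares of part S-c);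
  **`isWeilTypeCM_member_of_isogenyPair_weilTypeCM_chart`** — with the reverse pair at `s₀` (`u ≫ φ₀ = φ_{s₀} ≫ u`, `v ≫ u = n·𝟙_{A₀}`) EVERY
  member `(A_s, φ_s)` is of Weil type relative to `E` (§2 at `s₀`, then part R-c along the pencil). No θ_N, no group law, no Verdier, no `HC_CM`.

## Honest status

Fact-free bookkeeping that frees part R-b's anchors from the companion presentation: any `E`-isogeny class containing a member with algebraic
`E`-Weil classes anchors the pencil. Existence of compact pencils with a global `E`-action through a given member is NOT constructed (hypotheses,
as on the whole axis); which δ-components are met is part S-b's import of ring2-b03. Strength of the open instances unchanged (`B⋆` of the one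
total space); nothing minimal claimed; N104 untouched. EDGE LABELS: all theorems K (fact-free).
References: Deligne1982HodgeCycles (§4 (4.4), Prop. 4.4, Lemma 4.5, Remark 4.10, proof of Thm. 4.8); MoonenZarhin1998WeilClasses (§1, Criterion,
`n_σ + n_σ' = 2g/[F:ℚ]`); Andre1996Motifs (§6.3 Lemme 6.3.3, Remarque 2); Abdulali1994FamiliesAV (Thm. 5.5); vanGeemen1994HodgeAV (3.6, Lemma 3.7);
MumfordAV1970 (§1 (3), §19); Andre2026 (§4.4.4).
-/

noncomputable section

set_option linter.dupNamespace false

namespace Summit.HodgeConjecture.HodgeConjecture.Ring2.AbelianAll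

open CategoryTheory AlgebraicGeometry Polynomial
open Literature.AlgebraicGeometry Literature.AlgebraicGeometry.Motives
open Literature.AlgebraicGeometry.HodgeTheory Literature.AlgebraicGeometry.Deligne1982
open Literature.AlgebraicTopology.SingularHomology (singularCohomology)

/-! ## §1 `E`-equivariant pull-backs and `E`-isogeny pairs: the `E`-Weil classes (abelian-variety level) -/

section Isogeny

variable {A B : AbelianVariety ℂ} {φ : A ⟶ A} {ψ : B ⟶ B}

/-- **An `E`-equivariant homomorphism pulls `W_E ⊗ ℂ` back into `W_E ⊗ ℂ`**: for `g : B ⟶ A` with `g ≫ φ = ψ ≫ g`,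
`g^*(W(A, φ; P, r)) ⊆ W(B, ψ; P, r)` — summand by summand, `g^*` carries the joint eigenclasses of the test pull-backs `(x·𝟙 + y·φ)^*` with
character `(x + yρ)^r` to those of `(x·𝟙 + y·ψ)^*` (the tree's `HodgeTheory.map_mem_pullbackEigenclasses_of_comm`). [cite: MoonenZarhin1998WeilClasses, §1 (W_F ⊗ ℂ = ⊕_σ ⋀^r V_{ℂ,σ})]
[cite: Deligne1982HodgeCycles, §4 Remark 4.10] -/
theorem weilClassesField_map_le_of_comm {g : B ⟶ A} (hg : g ≫ φ = ψ ≫ g) (P : Polynomial ℤ) (r : ℕ) :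
    (weilClassesField A φ P r).map (complexBetti.map g.hom.hom.hom r).hom ≤ weilClassesField B ψ P r := by
  rw [Submodule.map_le_iff_le_comap]
  unfold weilClassesField
  refine iSup₂_le fun ρ hρ => ?_
  intro c hc
  rw [Submodule.mem_comap]
  exact pullbackEigenclasses_le_weilClassesField hρ (Literature.AlgebraicGeometry.HodgeTheory.map_mem_pullbackEigenclasses_of_comm hg hc)

/-- Elementwise: `c ∈ W_E(A, φ) ⊗ ℂ ⟹ g^* c ∈ W_E(B, ψ) ⊗ ℂ` for `g ≫ φ = ψ ≫ g`. [cite: MoonenZarhin1998WeilClasses, §1] [cite: Deligne1982HodgeCycles, §4 Remark 4.10] -/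
theorem map_mem_weilClassesField_of_comm {g : B ⟶ A} (hg : g ≫ φ = ψ ≫ g) {P : Polynomial ℤ} {r : ℕ} {c : complexBetti A.X r}
    (hc : c ∈ weilClassesField A φ P r) :
    complexBetti.map g.hom.hom.hom r c ∈ weilClassesField B ψ P r :=
  weilClassesField_map_le_of_comm hg P r ⟨c, hc, rfl⟩

/-- **ALGEBRAICITY OF THE `E`-WEIL CLASSES PASSES ALONG AN `E`-ISOGENY PAIR** (Deligne's Remark 4.10 along an isogeny, anchor-free form). If
`W_E(A₀, φ₀) ⊗ ℂ ⊆ Nᵏ(A₀)` (in degree `2k`) and `(Y, ψ)` is `E`-isogenous to `(A₀, φ₀)` — `u : Y ⟶ A₀`, `v : A₀ ⟶ Y`, `u ≫ v = m·𝟙_Y` (`m ≥ 1`),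
`v ≫ ψ = φ₀ ≫ v` — then `W_E(Y, ψ) ⊗ ℂ ⊆ Nᵏ(Y)`: for a Weil class `c` of `Y`, `v^* c` is a Weil class of `A₀`, hence algebraic; `u^* v^* c =
[m]^* c = m^{2k} c` is algebraic (pull-backs of algebraic classes along homomorphisms of abelian varieties are algebraic), hence so is `c`. The
companion-tensor-point case is the tree's `weilClassesField_le_algebraicClasses_of_isogenyPair_companion`. [cite: Deligne1982HodgeCycles, §4 Lemma 4.5 and Remark 4.10]
[cite: vanGeemen1994HodgeAV, 3.6 and Lemma 3.7] [cite: MumfordAV1970, §1 (3) and §19] -/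
theorem weilClassesField_le_algebraicClasses_of_isogenyPair {A₀ Y : AbelianVariety ℂ} {φ₀ : A₀ ⟶ A₀} {ψ : Y ⟶ Y}
    {P : Polynomial ℤ} {k m : ℕ} (hA : weilClassesField A₀ φ₀ P (2 * k) ≤ algebraicClasses A₀.X k)
    {u : Y ⟶ A₀} {v : A₀ ⟶ Y} (hm : 0 < m) (huv : u ≫ v = m • 𝟙 Y) (hv : v ≫ ψ = φ₀ ≫ v) :
    weilClassesField Y ψ P (2 * k) ≤ algebraicClasses Y.X k := by
  intro c hc
  have hvc : complexBetti.map v.hom.hom.hom (2 * k) c ∈ weilClassesField A₀ φ₀ P (2 * k) := map_mem_weilClassesField_of_comm hv hc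
  have hvalg : complexBetti.map v.hom.hom.hom (2 * k) c ∈ algebraicClasses A₀.X k := hA hvc
  have huvalg : complexBetti.map u.hom.hom.hom (2 * k) (complexBetti.map v.hom.hom.hom (2 * k) c) ∈ algebraicClasses Y.X k :=
    map_mem_algebraicClasses_of_abelianVariety AbelianVariety.isSmoothProjective_holds A₀ u.hom.hom.hom hvalg
  have e : complexBetti.map u.hom.hom.hom (2 * k) (complexBetti.map v.hom.hom.hom (2 * k) c) = ((m : ℂ) ^ (2 * k)) • c := by
    change singularCohomology.map ℂ ℂ (Motives.AlgPoints.mapContinuous (L := ℂ) u.hom.hom.hom) (2 * k)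
      (singularCohomology.map ℂ ℂ (Motives.AlgPoints.mapContinuous (L := ℂ) v.hom.hom.hom) (2 * k) c) = _
    rw [abelianVarietyHom_map_map_apply, huv]
    exact complexBetti_map_nsmul_id_apply Y m (2 * k) c
  rw [e] at huvalg
  have hm' : ((m : ℂ) ^ (2 * k)) ≠ 0 := pow_ne_zero _ (Nat.cast_ne_zero.2 hm.ne')
  exact (Submodule.smul_mem_iff _ hm').1 huvalg

end Isogeny

/-! ## §2 Weil type relative to `E` is an `E`-isogeny invariant (abelian-variety level) -/

section WeilType

variable {A₀ Y : AbelianVariety ℂ} {φ₀ : A₀ ⟶ A₀} {ψ : Y ⟶ Y} {R : Polynomial ℤ} {e₀ k : ℕ}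

/-- **WEIL TYPE RELATIVE TO `E` IS AN `E`-ISOGENY INVARIANT.** Let `(A₀, φ₀)` be of Weil type relative to `E = ℚ[T]/(R(T²))`
(`IsWeilTypeCM A₀ φ₀ R e₀ k`: Deligne's `a_σ = k` at every embedding) and `(Y, ψ)` with `R(ψ²) = 0`, `dim Y = dim A₀`, linked to it by
`u : Y ⟶ A₀` with `u ≫ φ₀ = ψ ≫ u` and `v : A₀ ⟶ Y` with `v ≫ u = m·𝟙_{A₀}`, `m ≥ 1` (an `E`-isogeny and a quasi-inverse). Then
**`IsWeilTypeCM Y ψ R e₀ k`.** Proof (as in part R-c): `W_E(A₀) ⊗ ℂ` carries a non-zero RATIONAL class `γ` (the tree's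
`exists_isRationalClass_ne_zero_mem_weilClassesField`), of type `(k, k)` since the anchor is of Weil type (Deligne Prop. 4.4 ⟸); `u^* γ` lies in
`W_E(Y) ⊗ ℂ` (§1), is rational, of type `(k, k)`, and non-zero (`v^* u^* γ = [m]^* γ = m^{2k} γ ≠ 0`); by Moonen–Zarhin's criterion (the tree's
theorem `exists_isRationalClass_isOfHodgeType_ne_zero_iff_balanced`) the multiplicities of `(Y, ψ)` are balanced, `n_ρ = n_ρ̄`, and
`n_ρ + n_ρ̄ = 2k` (`eigenMultiplicity_add_eigenMultiplicity_conj_eq`). [cite: Deligne1982HodgeCycles, §4 (4.4), Prop. 4.4 and proof of Thm. 4.8 (a)]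
[cite: MoonenZarhin1998WeilClasses, §1 (Criterion; n_σ + n_σ' = 2g/[F:ℚ])] [cite: vanGeemen1994HodgeAV, 3.6] -/
theorem isWeilTypeCM_of_isogenyPair (hW : IsWeilTypeCM A₀ φ₀ R e₀ k)
    (hψ : Polynomial.eval₂ (Int.castRingHom (CategoryTheory.End Y)) (ψ : CategoryTheory.End Y) (R.comp (X ^ 2)) = 0)
    (hdim : Y.dim = A₀.dim) {u : Y ⟶ A₀} {v : A₀ ⟶ Y} {m : ℕ} (hm : 0 < m) (hvu : v ≫ u = m • 𝟙 A₀)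
    (hu : u ≫ φ₀ = ψ ≫ u) : IsWeilTypeCM Y ψ R e₀ k := by
  have hdimY : Y.dim = 2 * k * e₀ := by rw [hdim, hW.dim_eq]
  have her₀ : (2 * e₀) * (2 * k) = 2 * A₀.dim := by rw [hW.dim_eq]; ring
  have herY : (2 * e₀) * (2 * k) = 2 * Y.dim := by rw [hdimY]; ring
  have hX₀ : IsSmoothProjective A₀.dim A₀.X := AbelianVariety.isSmoothProjective_holds
  have hXY : IsSmoothProjective Y.dim Y.X := AbelianVariety.isSmoothProjective_holds
  -- a non-zero rational Weil class of the anchor, of type `(k, k)`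
  obtain ⟨γ, hγW, hγQ, hγ0⟩ := exists_isRationalClass_ne_zero_mem_weilClassesField (A := A₀) (φ := φ₀) hW.monic_comp hW.natDegree_comp
    hW.irreducible hW.eval₂_eq_zero her₀
  have hγH : IsOfHodgeType A₀.dim A₀.X (2 * k) k k γ := hW.isOfHodgeType_of_mem_weilClassesField' hγW
  -- its pull-back to `Y`
  have huW : complexBetti.map u.hom.hom.hom (2 * k) γ ∈ weilClassesField Y ψ (R.comp (X ^ 2)) (2 * k) :=
    map_mem_weilClassesField_of_comm hu hγW
  have huQ : IsRationalClass (complexBetti.map u.hom.hom.hom (2 * k) γ) := hγQ.map (AlgPoints.mapContinuous (L := ℂ) u.hom.hom.hom)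
  have huH : IsOfHodgeType Y.dim Y.X (2 * k) k k (complexBetti.map u.hom.hom.hom (2 * k) γ) :=
    hγH.map_of_isSmoothProjective hXY hX₀ u.hom.hom.hom
  have hu0 : complexBetti.map u.hom.hom.hom (2 * k) γ ≠ 0 := by
    intro h0
    have e : complexBetti.map v.hom.hom.hom (2 * k) (complexBetti.map u.hom.hom.hom (2 * k) γ) = ((m : ℂ) ^ (2 * k)) • γ := by
      change singularCohomology.map ℂ ℂ (Motives.AlgPoints.mapContinuous (L := ℂ) v.hom.hom.hom) (2 * k)
        (singularCohomology.map ℂ ℂ (Motives.AlgPoints.mapContinuous (L := ℂ) u.hom.hom.hom) (2 * k) γ) = _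
      rw [abelianVarietyHom_map_map_apply, hvu]
      exact complexBetti_map_nsmul_id_apply A₀ m (2 * k) γ
    rw [h0, map_zero] at e
    exact hγ0 ((smul_eq_zero.1 e.symm).resolve_left (pow_ne_zero _ (Nat.cast_ne_zero.2 hm.ne')))
  -- Moonen–Zarhin: balanced multiplicities on `Y`, adding up to `2k`
  have hbal := (exists_isRationalClass_isOfHodgeType_ne_zero_iff_balanced (A := Y) (φ := ψ) hW.monic_comp hW.natDegree_comp
    hW.irreducible hψ herY (by have := hW.k_pos; omega)).1
    ⟨_, huW, huQ, by rw [show 2 * k / 2 = k by omega]; exact huH, hu0⟩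
  refine
    { e₀_pos := hW.e₀_pos
      k_pos := hW.k_pos
      monic := hW.monic
      natDegree_eq := hW.natDegree_eq
      irreducible := hW.irreducible
      root_real_neg := hW.root_real_neg
      eval₂_eq_zero := hψ
      dim_eq := hdimY
      multiplicity_eq := fun ρ hρ ↦ ?_ }
  have hsum := eigenMultiplicity_add_eigenMultiplicity_conj_eq (A := Y) (φ := ψ) hW.monic_comp hW.natDegree_comp hW.irreducible hψ herY hρ
  have hb := hbal ρ hρ
  omega

end WeilType

/-! ## §3 The pencil rows through a chart `E`-isogenous to an anchor -/

section Pencil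

variable {𝒳 S : SchemeOver ℂ} {f : 𝒳 ⟶ S} {d : ℕ}

/-- **THE ROW THROUGH A CHART `E`-ISOGENOUS TO ANY ANCHOR WITH ALGEBRAIC `E`-WEIL CLASSES.** Compact pencil `f : 𝒳 ⟶ S` of abelian `d`-folds
with `B⋆(𝒳, η)` for every `η`, a global endomorphism `Φ` over `S`, `Φ`-compatible charts `(A_s, e_s, φ_s)` with `P(φ_s) = 0` on every chart
(`P ∈ ℤ[T]` irreducible of degree `e`, `e · 2m = 2d`, `m ≥ 1`), a RATIONAL global `U ∈ H^{2m}(𝒳(ℂ); ℂ)` with `e_t^*(U|X_t) ∈ W_E(A_t, φ_t) ⊗ ℂ`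
and `U|X_t ≠ 0` at one member, and ONE chart `(A_{s₀}, φ_{s₀})` `E`-ISOGENOUS to an abelian variety `(A₀, φ₀)` whose `E`-Weil classes are
algebraic (`u : A_{s₀} ⟶ A₀`, `v : A₀ ⟶ A_{s₀}`, `u ≫ v = n·𝟙`, `n ≥ 1`, `v ≫ φ_{s₀} = φ₀ ≫ v`; `W_E(A₀, φ₀) ⊗ ℂ ⊆ Nᵐ(A₀)`) ⟹
**`W_E(A_s, φ_s) ⊗ ℂ ⊆ Nᵐ(A_s)` for EVERY member `s`.** §1 at the chart, then part R-b §1. No θ_N, no group law, no Verdier, no `HC_CM`.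
[cite: Deligne1982HodgeCycles, §4 Lemma 4.5, Remark 4.10 and proof of Thm. 4.8] [cite: MoonenZarhin1998WeilClasses, §1 (dim_F W_F = 1)]
[cite: Andre1996Motifs, §6.3 Lemme 6.3.3 and Remarque 2 (p. 33)] [cite: Abdulali1994FamiliesAV, Theorem 5.5 (p. 1130)] -/
theorem weilClassesField_le_algebraicClasses_forall_of_lefschetzB_of_isogenyPair_chart
    (hf : IsCompactAbelianPencil f d) (hB : ∀ ηX : complexBetti 𝒳 2, StandardConjectureBStar (d + 1) 𝒳 ηX)
    (Φ : 𝒳 ⟶ 𝒳) (hΦ : Φ ≫ f = f)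
    (A : ComplexPoints S → AbelianVariety ℂ) (e : ∀ s, (A s).X ≅ fiberOver f s) (φ : ∀ s, A s ⟶ A s)
    (hK : ∀ s, ∃ Φs : fiberOver f s ⟶ fiberOver f s, Φs ≫ fiberι f s = fiberι f s ≫ Φ ∧ (e s).hom ≫ Φs = (φ s).hom.hom.hom ≫ (e s).hom)
    {P : Polynomial ℤ} {eP m : ℕ} (hPe : P.natDegree = eP) (hPirr : Irreducible (P.map (Int.castRingHom ℚ)))
    (hP : ∀ s, Polynomial.eval₂ (Int.castRingHom (CategoryTheory.End (A s))) ((φ s : CategoryTheory.End (A s))) P = 0)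
    (her : eP * (2 * m) = 2 * d) (hm : 0 < m)
    (U : complexBetti 𝒳 (2 * m)) (hUQ : IsRationalClass U) {t : ComplexPoints S}
    (hUt : complexBetti.map (e t).hom (2 * m) (complexBetti.map (fiberι f t) (2 * m) U) ∈ weilClassesField (A t) (φ t) P (2 * m))
    (hU0 : complexBetti.map (fiberι f t) (2 * m) U ≠ 0)
    {A₀ : AbelianVariety ℂ} {φ₀ : A₀ ⟶ A₀} (hA₀ : weilClassesField A₀ φ₀ P (2 * m) ≤ algebraicClasses A₀.X m)
    {s₀ : ComplexPoints S} (u : A s₀ ⟶ A₀) (v : A₀ ⟶ A s₀) {n : ℕ} (hn : 0 < n) (huv : u ≫ v = n • 𝟙 (A s₀))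
    (hv : v ≫ φ s₀ = φ₀ ≫ v) (s : ComplexPoints S) :
    weilClassesField (A s) (φ s) P (2 * m) ≤ algebraicClasses (A s).X m :=
  weilClassesField_le_algebraicClasses_forall_of_lefschetzB_of_weilClassesField_le_chart hf hB Φ hΦ A e φ hK hPe hPirr hP her hm U hUQ hUt hU0
    (weilClassesField_le_algebraicClasses_of_isogenyPair hA₀ hn huv hv) s

/-- **THE ROW THROUGH A CHART `E`-ISOGENOUS TO A WEIL-TYPE CM DATUM SATISFYING THE HODGE CONJECTURE** (the anchors of ring2-b03 on every
δ-row — part S-b —, the CM-field twisted squares with HC — parts S-c/S-d —, Deligne's tensor points — part R-e): compact pencil of abelian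
`2ke₀`-folds with `B⋆ ∀η`, global `E`-action (`Φ`; charts `(A_s, e_s, φ_s)` with `R(φ_s²) = 0`), a rational global `U` on `W_E(A_t) ⊗ ℂ` at `t`
with `U|X_t ≠ 0`, and ONE chart `A_{s₀}` `E`-isogenous (`u ≫ v = n·𝟙`, `v ≫ φ_{s₀} = φ₀ ≫ v`) to `(A₀, φ₀)` with `IsWeilTypeCM A₀ φ₀ R e₀ k` and
`HodgeConjectureFor A₀` ⟹ `W_E(A_s, φ_s) ⊗ ℂ ⊆ Nᵏ(A_s)` for EVERY member. (The anchor's Weil classes are of type `(k, k)` and span a rational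
space, so HC makes them algebraic: the tree's `IsWeilTypeCM.weilClassesField_le_algebraicClasses_of_hodgeConjectureFor`; then the previous row.)
[cite: Deligne1982HodgeCycles, §4 (4.4), Prop. 4.4 and Remark 4.10] [cite: MoonenZarhin1998WeilClasses, §1 (Criterion)]
[cite: Andre1996Motifs, §6.3 Lemme 6.3.3 and Remarque 2 (p. 33)] -/
theorem weilClassesField_le_algebraicClasses_forall_of_lefschetzB_of_isogenyPair_weilTypeCM_hodge_chart {R : Polynomial ℤ} {e₀ k : ℕ}
    (hf : IsCompactAbelianPencil f (2 * k * e₀)) (hB : ∀ ηX : complexBetti 𝒳 2, StandardConjectureBStar (2 * k * e₀ + 1) 𝒳 ηX)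
    (Φ : 𝒳 ⟶ 𝒳) (hΦ : Φ ≫ f = f)
    (A : ComplexPoints S → AbelianVariety ℂ) (e : ∀ s, (A s).X ≅ fiberOver f s) (φ : ∀ s, A s ⟶ A s)
    (hK : ∀ s, ∃ Φs : fiberOver f s ⟶ fiberOver f s, Φs ≫ fiberι f s = fiberι f s ≫ Φ ∧ (e s).hom ≫ Φs = (φ s).hom.hom.hom ≫ (e s).hom)
    (hP : ∀ s, Polynomial.eval₂ (Int.castRingHom (CategoryTheory.End (A s))) ((φ s : CategoryTheory.End (A s)))
      (R.comp (X ^ 2)) = 0)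
    (U : complexBetti 𝒳 (2 * k)) (hUQ : IsRationalClass U) {t : ComplexPoints S}
    (hUt : complexBetti.map (e t).hom (2 * k) (complexBetti.map (fiberι f t) (2 * k) U) ∈
      weilClassesField (A t) (φ t) (R.comp (X ^ 2)) (2 * k))
    (hU0 : complexBetti.map (fiberι f t) (2 * k) U ≠ 0)
    {A₀ : AbelianVariety ℂ} {φ₀ : A₀ ⟶ A₀} (hW₀ : IsWeilTypeCM A₀ φ₀ R e₀ k) (hHC₀ : HodgeConjectureFor A₀.dim A₀.X)
    {s₀ : ComplexPoints S} (u : A s₀ ⟶ A₀) (v : A₀ ⟶ A s₀) {n : ℕ} (hn : 0 < n) (huv : u ≫ v = n • 𝟙 (A s₀))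
    (hv : v ≫ φ s₀ = φ₀ ≫ v) (s : ComplexPoints S) :
    weilClassesField (A s) (φ s) (R.comp (X ^ 2)) (2 * k) ≤ algebraicClasses (A s).X k := by
  have her : (2 * e₀) * (2 * k) = 2 * (2 * k * e₀) := by ring
  exact weilClassesField_le_algebraicClasses_forall_of_lefschetzB_of_isogenyPair_chart hf hB Φ hΦ A e φ hK hW₀.natDegree_comp hW₀.irreducible
    hP her hW₀.k_pos U hUQ hUt hU0 (hW₀.weilClassesField_le_algebraicClasses_of_hodgeConjectureFor hHC₀) u v hn huv hv s

/-- **EVERY MEMBER IS OF WEIL TYPE RELATIVE TO `E` through a chart `E`-isogenous to a Weil-type CM datum.** Compact pencil of abelian `d`-folds,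
global `E`-action (`Φ`; charts `(A_s, e_s, φ_s)` with `R(φ_s²) = 0`), a rational global `U` on `W_E(A_t) ⊗ ℂ` at `t` with `U|X_t ≠ 0`, and ONE
chart `(A_{s₀}, φ_{s₀})` linked to `(A₀, φ₀)` of Weil type (`IsWeilTypeCM A₀ φ₀ R e₀ k`) by `u : A_{s₀} ⟶ A₀` with `u ≫ φ₀ = φ_{s₀} ≫ u` and
`v : A₀ ⟶ A_{s₀}` with `v ≫ u = n·𝟙_{A₀}` (`n ≥ 1`), `dim A_{s₀} = dim A₀` ⟹ `IsWeilTypeCM (A s) (φ s) R e₀ k` for EVERY member `s`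
(§2 at `s₀`, then part R-c's constancy of Weil type along the pencil). No `B⋆` needed. [cite: Deligne1982HodgeCycles, §4 Prop. 4.4 and proof of Thm. 4.8 (a)]
[cite: MoonenZarhin1998WeilClasses, §1 (Criterion)] [cite: Andre1996Motifs, §6.3 Lemme 6.3.3 (iii) (p. 33)] -/
theorem isWeilTypeCM_member_of_isogenyPair_weilTypeCM_chart {R : Polynomial ℤ} {e₀ k : ℕ} (hf : IsCompactAbelianPencil f d)
    (Φ : 𝒳 ⟶ 𝒳) (hΦ : Φ ≫ f = f)
    (A : ComplexPoints S → AbelianVariety ℂ) (e : ∀ s, (A s).X ≅ fiberOver f s) (φ : ∀ s, A s ⟶ A s)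
    (hK : ∀ s, ∃ Φs : fiberOver f s ⟶ fiberOver f s, Φs ≫ fiberι f s = fiberι f s ≫ Φ ∧ (e s).hom ≫ Φs = (φ s).hom.hom.hom ≫ (e s).hom)
    (hP : ∀ s, Polynomial.eval₂ (Int.castRingHom (CategoryTheory.End (A s))) ((φ s : CategoryTheory.End (A s)))
      (R.comp (X ^ 2)) = 0)
    (U : complexBetti 𝒳 (2 * k)) (hUQ : IsRationalClass U) {t : ComplexPoints S}
    (hUt : complexBetti.map (e t).hom (2 * k) (complexBetti.map (fiberι f t) (2 * k) U) ∈
      weilClassesField (A t) (φ t) (R.comp (X ^ 2)) (2 * k))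
    (hU0 : complexBetti.map (fiberι f t) (2 * k) U ≠ 0)
    {A₀ : AbelianVariety ℂ} {φ₀ : A₀ ⟶ A₀} (hW₀ : IsWeilTypeCM A₀ φ₀ R e₀ k)
    {s₀ : ComplexPoints S} (hdim : (A s₀).dim = A₀.dim) (u : A s₀ ⟶ A₀) (v : A₀ ⟶ A s₀) {n : ℕ} (hn : 0 < n)
    (hvu : v ≫ u = n • 𝟙 A₀) (hu : u ≫ φ₀ = φ s₀ ≫ u) (s : ComplexPoints S) :
    IsWeilTypeCM (A s) (φ s) R e₀ k :=
  (isWeilTypeCM_member_iff_member hf Φ hΦ A e φ hK hP U hUQ hUt hU0 s₀ s).1 (isWeilTypeCM_of_isogenyPair hW₀ (hP s₀) hdim hn hvu hu)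

end Pencil

end Summit.HodgeConjecture.HodgeConjecture.Ring2.AbelianAll

end
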